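import Mathlib
import Literature.Combinatorics.Optimization.MaxCutCspHardness
import Literature.Analysis.Convex.LinearProgrammingDuality
import HarnessLib

/-!
# LP formulations of optimization problems: Yannakakis' factorization theorem for approximations and reductions (Braun–Pokutta–Zink 2015, Braun–Pokutta–Roy 2016)

The LP half of the Braun–Pokutta–Zink framework, companion of `SdpFormulationReductions.lean`.  Source:
G. Braun, S. Pokutta, A. Roy, *Strong reductions for extended formulations*, arXiv:1512.04932v3, §2.2
[BraunPokuttaRoy2016] (= [cite: BraunPokuttaZink2015, §3–§4] without the nonnegativity-problem layer).
All PROVED, no named facts: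

* `LPFormulation P R` — **Def. 2.23** "a `(C,S)`-approximate LP formulation of `𝒫`: a linear program
  `Ax ≤ b` with `x ∈ ℝ^r` … (Feasible solutions) vectors `x^s` with `A x^s ≤ b`, (Instances) affine
  functions `w_𝔍` with `w_𝔍(x^s) = val_𝔍(s)` for the sound `𝔍`, (Achieving) `max {w_𝔍(x) | Ax ≤ b} ≤ C(𝔍)`
  for the sound `𝔍`.  The SIZE of the formulation is the number of inequalities in `Ax ≤ b`."
* **Factorization theorem, LP case (Thm. 2.26 / Thm. 2.20: `fc(𝒫, C, S) = rk_LP M_{𝒫,C,S}`)**, both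
  directions, in nonnegative-rank currency (`rk_LP` and `rk_+` differ by at most one, Remark 2.19 — the
  tree's `HasNonnegFactorization` has no separate "`+ u·𝟙`" summand):
  `LPFormulation.hasNonnegFactorization_slackMatrix` (a formulation of size `R` gives a nonnegative
  factorization of the slack matrix of size `R + 1`; the printed Farkas step is the tree's affine Farkas
  lemma `Literature.Analysis.Convex.LPDuality.affine_farkas` = Schrijver Cor. 7.1h) and
  `LPFormulation.ofNonnegFactorization` ("Conversely …": the LP `x ≥ 0`, `x^s =` the column factor,
  `w_𝔍(x) = C(𝔍) − u_𝔍 x`).  So `fc ≤ rk_+(M_{𝒫,C,S}) ≤ fc + 1`.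
* Nonnegative-rank calculus used by Thm. 2.22 ("the well-known identities `rk_+(A ∘ B) ≤ rk_+ A · rk_+ B`,
  `rk_+(ABC) ≤ rk_+ B`, `rk(A + B) ≤ …`"): `HasNonnegFactorization.submatrix/hadamard/add`,
  `hasNonnegFactorization_of_rowConst`.
* **Thm. 3.2, LP clause**: `MaxProblem.Reduction.hasNonnegFactorization_slackMatrix`
  (`rk_+(M_{𝒫₁}) ≤ rk_+(M₁)·rk_+(M_{𝒫₂}) + rk_+(M₂)`), `…_affine` (`+1`), `Reduction.isEmpty_lpFormulation(_affine)`,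
  `Reduction.lpFormulation`.
* Consequences with the tree's Chan–Lee–Raghavendra–Steurer × Schoenebeck bounds: `maxKXor_nnr`
  (no nonnegative factorization of `M^{n,k-XOR}_{1−ε,1/2+ε}` of size `≤ n^{d/2} + 1`),
  `maxKXor_lpFormulation_poly` (Max-`k`-XOR has no `(1−ε, 1/2+ε)`-approximate LP formulation of size
  `≤ n^{d/2}` — [cite: BraunPokuttaZink2015, Thm. 4.5] for `k`-XOR, with `n^{d/2}` for every `d` in place
  of `n^{Ω(log n/log log n)}`, PROVED), and through the gadget reductions of `MaxCutSdpHardness.lean` /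
  `MaxCutCspHardness.lean`: `maxCut_lpFormulation_poly` (weighted MaxCUT on `N = 1 + 2n + 36n³` vertices
  has no `((17−2ε)/21·W, (16+2ε)/21·W)`-approximate LP formulation of size `≤ N^C`; the MaxCUT clause of
  [cite: BraunPokuttaZink2015, Thm. 4.5] with the gadget constant, UNCONDITIONAL — the printed
  `(1−ε, 1/2+ε)` rests on [CMM09], in the tree the named fact `CharikarMakarychevMakarychev2009_maxCutSA`).
-/

noncomputable section

open Finset Matrix Real Filter

namespace Literature.Combinatorics.Optimization

open Literature.Analysis.Convex (LPDuality.affine_farkas)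

variable {σ φ σ₁ φ₁ σ₂ φ₂ : Type*}

/-! ### Nonnegative-rank calculus -/

namespace HasNonnegFactorization

variable {ι κ : Type*}

/-- Submatrices: `rk_+(F M G) ≤ rk_+(M)` for row/column selections. [cite: BraunPokuttaRoy2016, proof of Thm. 2.22 (arXiv v3)] -/
theorem submatrix {ι' κ' : Type*} {M : ι → κ → ℝ} {r : ℕ} (h : HasNonnegFactorization M r)
    (f : ι' → ι) (g : κ' → κ) : HasNonnegFactorization (fun i j => M (f i) (g j)) r := by
  obtain ⟨U, V, hU, hV, hM⟩ := h
  exact ⟨fun i => U (f i), fun l j => V l (g j), fun i l => hU _ _, fun l j => hV _ _, fun i j => hM _ _⟩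

/-- Hadamard products: `rk_+(A ∘ B) ≤ rk_+(A)·rk_+(B)`. [cite: BraunPokuttaRoy2016, proof of Thm. 2.22 (arXiv v3)] -/
theorem hadamard {A B : ι → κ → ℝ} {r s : ℕ} (hA : HasNonnegFactorization A r)
    (hB : HasNonnegFactorization B s) : HasNonnegFactorization (fun i j => A i j * B i j) (r * s) := by
  obtain ⟨U, V, hU, hV, hA⟩ := hA
  obtain ⟨U', V', hU', hV', hB⟩ := hB
  refine ⟨fun i l => U i (finProdFinEquiv.symm l).1 * U' i (finProdFinEquiv.symm l).2,
    fun l j => V (finProdFinEquiv.symm l).1 j * V' (finProdFinEquiv.symm l).2 j,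
    fun i l => mul_nonneg (hU _ _) (hU' _ _), fun l j => mul_nonneg (hV _ _) (hV' _ _), fun i j => ?_⟩
  show A i j * B i j = ∑ l : Fin (r * s), (U i (finProdFinEquiv.symm l).1 * U' i (finProdFinEquiv.symm l).2) *
    (V (finProdFinEquiv.symm l).1 j * V' (finProdFinEquiv.symm l).2 j)
  rw [hA, hB, sum_mul_sum, ← Fintype.sum_prod_type']
  exact (Fintype.sum_equiv finProdFinEquiv.symm _
    (fun p : Fin r × Fin s => U i p.1 * V p.1 j * (U' i p.2 * V' p.2 j)) (fun l => by ring)).symm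

/-- Sums: `rk_+(A + B) ≤ rk_+(A) + rk_+(B)`. [cite: BraunPokuttaRoy2016, proof of Thm. 2.22 (arXiv v3)] -/
theorem add {A B : ι → κ → ℝ} {r s : ℕ} (hA : HasNonnegFactorization A r)
    (hB : HasNonnegFactorization B s) : HasNonnegFactorization (fun i j => A i j + B i j) (r + s) := by
  obtain ⟨U, V, hU, hV, hA⟩ := hA
  obtain ⟨U', V', hU', hV', hB⟩ := hB
  refine ⟨fun i => Fin.append (U i) (U' i), fun l j => Fin.append (fun l => V l j) (fun l => V' l j) l,
    fun i l => ?_, fun l j => ?_, fun i j => ?_⟩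
  · refine Fin.addCases (fun l' => ?_) (fun l' => ?_) l <;> simp [hU, hU']
  · refine Fin.addCases (fun l' => ?_) (fun l' => ?_) l <;> simp [hV, hV']
  · rw [Fin.sum_univ_add]
    simp only [Fin.append_left, Fin.append_right]
    rw [hA, hB]

end HasNonnegFactorization

/-- A matrix constant along rows with nonnegative entries has a nonnegative factorization of size `1`.
[cite: BraunPokuttaRoy2016, proof of Thm. 2.22 (arXiv v3)] -/
theorem hasNonnegFactorization_of_rowConst {ι κ : Type*} {M : ι → κ → ℝ} (lam : ι → ℝ)
    (hM : ∀ i j, M i j = lam i) (hnn : ∀ i j, 0 ≤ M i j) : HasNonnegFactorization M 1 := by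
  rcases isEmpty_or_nonempty κ with hκ | ⟨⟨j₀⟩⟩
  · exact ⟨fun _ _ => 0, fun _ j => isEmptyElim j, fun _ _ => le_rfl, fun _ j => isEmptyElim j,
      fun _ j => isEmptyElim j⟩
  · refine ⟨fun i _ => lam i, fun _ _ => 1, fun i _ => ?_, fun _ _ => zero_le_one, fun i j => by simp [hM i j]⟩
    show 0 ≤ lam i
    rw [← hM i j₀]; exact hnn i j₀

/-! ### LP formulations (Def. 2.23) -/

/-- **Def. 2.23 (`(C,S)`-approximate LP formulation of a maximization problem, of size `R`).**  A linear
program `A x ≤ b` (`R` inequalities, `x ∈ ℝ^D`), feasible vectors `x^s` realising the feasible solutions,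
and affine functions `w_𝔍(x) = ⟨w_𝔍, x⟩ + c_𝔍` realising the instances, exact on sound instances
(`w_𝔍(x^s) = val_𝔍(s)`) and achieving the guarantee (`w_𝔍(x) ≤ C(𝔍)` whenever `A x ≤ b`).
[cite: BraunPokuttaRoy2016, Def. 2.23 (arXiv v3)] [cite: BraunPokuttaZink2015, Def. 2.5 (LP formulation)] -/
structure LPFormulation {σ φ : Type*} (P : MaxProblem σ φ) (R : ℕ) where
  /-- number of variables of the linear program -/
  D : ℕ
  /-- constraint matrix -/
  A : Matrix (Fin R) (Fin D) ℝ
  /-- right-hand side -/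
  b : Fin R → ℝ
  /-- the vectors `x^s` -/
  x : σ → Fin D → ℝ
  /-- `A x^s ≤ b` -/
  mem : ∀ s i, (A *ᵥ x s) i ≤ b i
  /-- linear part of `w_𝔍` -/
  w : φ → Fin D → ℝ
  /-- constant part of `w_𝔍` -/
  c : φ → ℝ
  /-- `w_𝔍(x^s) = val_𝔍(s)` for sound `𝔍` -/
  exact : ∀ f, P.Sound f → ∀ s, w f ⬝ᵥ x s + c f = P.val f s
  /-- `max {w_𝔍(x) | A x ≤ b} ≤ C(𝔍)` for sound `𝔍` -/
  achieves : ∀ f, P.Sound f → ∀ y : Fin D → ℝ, (∀ i, (A *ᵥ y) i ≤ b i) → w f ⬝ᵥ y + c f ≤ P.C f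

/-! ### The factorization theorem, LP case (Thm. 2.26 / Thm. 2.20) -/

variable {R : ℕ}

/-- **Factorization theorem (LP), "formulation ⇒ factorization":** an LP formulation of size `R` gives a
nonnegative factorization of the slack matrix of size `R + 1`: by the affine form of Farkas' lemma
`w_𝔍(x) = u_𝔍·(b − A x) + γ_𝔍` with `u_𝔍, γ_𝔍 ≥ 0`, and substituting `x^s`.
[cite: BraunPokuttaRoy2016, Thm. 2.26 and proof of Thm. 2.20 (arXiv v3)] [cite: BraunPokuttaZink2015, Thm. 3.5 (LP)] -/
theorem LPFormulation.hasNonnegFactorization_slackMatrix {P : MaxProblem σ φ} (E : LPFormulation P R) :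
    HasNonnegFactorization P.slackMatrix (R + 1) := by
  classical
  rcases isEmpty_or_nonempty σ with hσ | ⟨⟨s₀⟩⟩
  · exact ⟨fun _ _ => 0, fun _ s => isEmptyElim s, fun _ _ => le_rfl, fun _ s => isEmptyElim s,
      fun _ s => isEmptyElim s⟩
  have hP : ∃ y : Fin E.D → ℝ, E.A *ᵥ y ≤ E.b := ⟨E.x s₀, fun i => E.mem s₀ i⟩
  -- Farkas multipliers for every sound instance
  have hfar : ∀ f : {f : φ // P.Sound f}, ∃ u : Fin R → ℝ, 0 ≤ u ∧ u ᵥ* E.A = E.w f.1 ∧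
      u ⬝ᵥ E.b ≤ P.C f.1 - E.c f.1 := fun f =>
    LPDuality.affine_farkas E.A E.b (E.w f.1) hP fun y hy => by
      have := E.achieves f.1 f.2 y (fun i => hy i); linarith
  choose u hu huA hub using hfar
  refine ⟨fun f => (Fin.snoc (α := fun _ => ℝ) (u f) (P.C f.1 - E.c f.1 - u f ⬝ᵥ E.b) : Fin (R + 1) → ℝ),
    fun l s => (Fin.snoc (α := fun _ => ℝ) (fun i : Fin R => E.b i - (E.A *ᵥ E.x s) i) (1 : ℝ) :
      Fin (R + 1) → ℝ) l, fun f l => ?_, fun l s => ?_, fun f s => ?_⟩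
  · refine Fin.lastCases ?_ (fun i => ?_) l
    · simp only [Fin.snoc_last]; linarith [hub f]
    · simp only [Fin.snoc_castSucc]; exact hu f i
  · refine Fin.lastCases ?_ (fun i => ?_) l
    · simp
    · simp only [Fin.snoc_castSucc]; linarith [E.mem s i]
  · rw [Fin.sum_univ_castSucc]
    simp only [Fin.snoc_castSucc, Fin.snoc_last, mul_one, MaxProblem.slackMatrix_apply]
    have hws : E.w f.1 ⬝ᵥ E.x s = u f ⬝ᵥ (E.A *ᵥ E.x s) := by
      rw [← huA f, Matrix.dotProduct_mulVec]
    have hex := E.exact f.1 f.2 s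
    have hsum : ∑ i : Fin R, u f i * (E.b i - (E.A *ᵥ E.x s) i) = u f ⬝ᵥ E.b - u f ⬝ᵥ (E.A *ᵥ E.x s) := by
      simp only [dotProduct, mul_sub, sum_sub_distrib]
    rw [hsum]
    linarith

/-- **Factorization theorem (LP), "factorization ⇒ formulation"** ("Conversely …" in the proof of Thm. 2.20):
a nonnegative factorization `C(𝔍) − val_𝔍(s) = u_𝔍 · x^s` of size `r` IS an LP formulation of size `r`:
the LP is `x ≥ 0` (`r` inequalities), `s` is realised by the column factor `x^s`, a sound instance by
`w_𝔍(x) = C(𝔍) − u_𝔍 · x`. [cite: BraunPokuttaRoy2016, Thm. 2.26 and proof of Thm. 2.20 (arXiv v3)]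
[cite: BraunPokuttaZink2015, Thm. 3.5 (LP)] -/
def LPFormulation.ofNonnegFactorization (P : MaxProblem σ φ) {r : ℕ}
    (U : {f : φ // P.Sound f} → Fin r → ℝ) (V : Fin r → σ → ℝ) (hU : ∀ f l, 0 ≤ U f l)
    (hV : ∀ l s, 0 ≤ V l s) (hM : ∀ f s, P.slackMatrix f s = ∑ l, U f l * V l s) : LPFormulation P r := by
  classical
  exact
  { D := r
    A := -1
    b := 0
    x := fun s l => V l s
    mem := fun s i => by simp [Matrix.neg_mulVec, hV i s]
    w := fun f => if h : P.Sound f then -U ⟨f, h⟩ else 0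
    c := fun f => P.C f
    exact := fun f hf s => by
      have h := hM ⟨f, hf⟩ s
      simp only [MaxProblem.slackMatrix_apply] at h
      simp only [dif_pos hf, dotProduct, Pi.neg_apply, neg_mul, Finset.sum_neg_distrib]
      linarith
    achieves := fun f hf y hy => by
      simp only [dif_pos hf, dotProduct, Pi.neg_apply, neg_mul, Finset.sum_neg_distrib]
      have hy' : ∀ l, 0 ≤ y l := fun l => by
        have := hy l; simpa [Matrix.neg_mulVec] using this
      have : 0 ≤ ∑ l, U ⟨f, hf⟩ l * y l := sum_nonneg fun l _ => mul_nonneg (hU _ _) (hy' l)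
      linarith }

/-- Hence `fc(𝒫, C, S) ≤ rk_+(M_{𝒫,C,S})`. [cite: BraunPokuttaRoy2016, Thm. 2.26 (arXiv v3)] -/
theorem LPFormulation.nonempty_of_hasNonnegFactorization {P : MaxProblem σ φ} {r : ℕ}
    (h : HasNonnegFactorization P.slackMatrix r) : Nonempty (LPFormulation P r) := by
  obtain ⟨U, V, hU, hV, hM⟩ := h
  exact ⟨LPFormulation.ofNonnegFactorization P U V hU hV hM⟩

/-- Lower bounds: no nonnegative factorization of the slack matrix of size `R + 1` ⇒ no LP formulation of
size `R`. [cite: BraunPokuttaRoy2016, Thm. 2.26 and Remark 2.19 (arXiv v3)] -/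
theorem LPFormulation.isEmpty_of_not_hasNonnegFactorization {P : MaxProblem σ φ}
    (h : ¬ HasNonnegFactorization P.slackMatrix (R + 1)) : IsEmpty (LPFormulation P R) :=
  ⟨fun E => h E.hasNonnegFactorization_slackMatrix⟩

/-! ### Thm. 3.2, LP clause -/

namespace MaxProblem.Reduction

variable {P₁ : MaxProblem σ₁ φ₁} {P₂ : MaxProblem σ₂ φ₂}

/-- **Thm. 3.2, LP clause, in nonnegative-rank currency:**
`rk_+(M_{𝒫₁}) ≤ rk_+(M₁)·rk_+(M_{𝒫₂}) + rk_+(M₂)`. [cite: BraunPokuttaRoy2016, Thm. 3.2 via Thm. 2.22 (arXiv v3)]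
[cite: BraunPokuttaZink2015, Prop. 4.2 (reductions of formulations)] -/
theorem hasNonnegFactorization_slackMatrix (Rd : P₁.Reduction P₂) {r r₁ r₂ : ℕ}
    (h₂ : HasNonnegFactorization P₂.slackMatrix r)
    (h₁ : HasNonnegFactorization (fun (f : {f : φ₁ // P₁.Sound f}) (s : σ₁) => Rd.M₁ f.1 s) r₁)
    (hM₂ : HasNonnegFactorization (fun (f : {f : φ₁ // P₁.Sound f}) (s : σ₁) => Rd.M₂ f.1 s) r₂) :
    HasNonnegFactorization P₁.slackMatrix (r * r₁ + r₂) := by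
  rw [Rd.slackMatrix_eq]
  exact ((h₂.submatrix Rd.instSound Rd.sol).hadamard h₁).add hM₂

/-- **Thm. 3.2 (LP) for affine reductions:** `rk_+(M_{𝒫₁}) ≤ rk_+(M_{𝒫₂}) + 1`.
[cite: BraunPokuttaRoy2016, Thm. 3.2 (arXiv v3)] [cite: BraunPokuttaZink2015, Prop. 4.2 (reductions of formulations)] -/
theorem hasNonnegFactorization_slackMatrix_affine (Rd : P₁.Reduction P₂) (lam mu : φ₁ → ℝ)
    (hM₁ : ∀ f s, Rd.M₁ f s = lam f) (hM₂ : ∀ f s, Rd.M₂ f s = mu f) {r : ℕ}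
    (h₂ : HasNonnegFactorization P₂.slackMatrix r) : HasNonnegFactorization P₁.slackMatrix (r + 1) := by
  have h₁ : HasNonnegFactorization (fun (f : {f : φ₁ // P₁.Sound f}) (s : σ₁) => Rd.M₁ f.1 s) 1 :=
    hasNonnegFactorization_of_rowConst (fun f => lam f.1) (fun f s => hM₁ f.1 s) (fun f s => Rd.M₁_nonneg f.1 s)
  have hμ : HasNonnegFactorization (fun (f : {f : φ₁ // P₁.Sound f}) (s : σ₁) => Rd.M₂ f.1 s) 1 :=
    hasNonnegFactorization_of_rowConst (fun f => mu f.1) (fun f s => hM₂ f.1 s) (fun f s => Rd.M₂_nonneg f.1 s)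
  simpa using Rd.hasNonnegFactorization_slackMatrix h₂ h₁ hμ

/-- **Thm. 3.2 (LP) at formulation level:** an LP formulation of `𝒫₂` of size `R` yields one of `𝒫₁` of size
`(R+1)·r₁ + r₂`. [cite: BraunPokuttaRoy2016, Thm. 3.2 (arXiv v3)] -/
def lpFormulation (Rd : P₁.Reduction P₂) (E : LPFormulation P₂ R) {r₁ r₂ : ℕ}
    (h₁ : HasNonnegFactorization (fun (f : {f : φ₁ // P₁.Sound f}) (s : σ₁) => Rd.M₁ f.1 s) r₁)
    (hM₂ : HasNonnegFactorization (fun (f : {f : φ₁ // P₁.Sound f}) (s : σ₁) => Rd.M₂ f.1 s) r₂) :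
    LPFormulation P₁ ((R + 1) * r₁ + r₂) :=
  Classical.choice (LPFormulation.nonempty_of_hasNonnegFactorization
    (Rd.hasNonnegFactorization_slackMatrix E.hasNonnegFactorization_slackMatrix h₁ hM₂))

/-- Lower-bound transfer (LP): no nonnegative factorization of `M_{𝒫₁}` of size `(R+1)·r₁ + r₂` ⇒ no LP
formulation of `𝒫₂` of size `R`. [cite: BraunPokuttaRoy2016, Thm. 3.2 (arXiv v3)] -/
theorem isEmpty_lpFormulation (Rd : P₁.Reduction P₂) {r₁ r₂ : ℕ}
    (h₁ : HasNonnegFactorization (fun (f : {f : φ₁ // P₁.Sound f}) (s : σ₁) => Rd.M₁ f.1 s) r₁)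
    (hM₂ : HasNonnegFactorization (fun (f : {f : φ₁ // P₁.Sound f}) (s : σ₁) => Rd.M₂ f.1 s) r₂)
    (hno : ¬ HasNonnegFactorization P₁.slackMatrix ((R + 1) * r₁ + r₂)) : IsEmpty (LPFormulation P₂ R) :=
  ⟨fun E => hno (Rd.hasNonnegFactorization_slackMatrix E.hasNonnegFactorization_slackMatrix h₁ hM₂)⟩

/-- Lower-bound transfer (LP) for affine reductions: no nonnegative factorization of `M_{𝒫₁}` of size `R + 2`
⇒ no LP formulation of `𝒫₂` of size `R`. [cite: BraunPokuttaRoy2016, Thm. 3.2 (arXiv v3)]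
[cite: BraunPokuttaZink2015, Prop. 4.2 (reductions of formulations)] -/
theorem isEmpty_lpFormulation_affine (Rd : P₁.Reduction P₂) (lam mu : φ₁ → ℝ)
    (hM₁ : ∀ f s, Rd.M₁ f s = lam f) (hM₂ : ∀ f s, Rd.M₂ f s = mu f)
    (hno : ¬ HasNonnegFactorization P₁.slackMatrix (R + 2)) : IsEmpty (LPFormulation P₂ R) :=
  ⟨fun E => hno (Rd.hasNonnegFactorization_slackMatrix_affine lam mu hM₁ hM₂
    E.hasNonnegFactorization_slackMatrix)⟩

end MaxProblem.Reduction

/-! ### Consequences: Max-`k`-XOR and MaxCUT -/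

section Consequences

variable {k n : ℕ} {P : Set ((Fin k → Bool) → Bool)} {c s : ℝ}

/-- The slack matrix of `cspProblem` is `M^{n,𝒫}_{c,s}` also for nonnegative factorizations.
[cite: BraunPokuttaRoy2016, Def. 2.25 (arXiv v3)] [cite: LeeRaghavendraSteurer2015, Prop. 6.1 (p. 25)] -/
theorem hasNonnegFactorization_cspProblem_iff {r : ℕ} :
    HasNonnegFactorization (cspProblem k n P c s).slackMatrix r ↔ HasNonnegFactorization (cspMatrix k n P c s) r :=
  ⟨fun h => h.submatrix
      (fun I : SoundInstances k n P s => (⟨I.1, I.2⟩ : {I : CSPInstance k n P // (cspProblem k n P c s).Sound I}))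
      id,
   fun h => h.submatrix
      (fun I : {I : CSPInstance k n P // (cspProblem k n P c s).Sound I} => (⟨I.1, I.2⟩ : SoundInstances k n P s))
      id⟩

/-- **Max-`k`-XOR: no nonnegative factorization of `M^{n,k-XOR}_{1−ε,1/2+ε}` of size `≤ n^{d/2} + 1`**
(`k ≥ 3`, `d ≥ k`, all large `n`; Chan–Lee–Raghavendra–Steurer Thm. 3.1 in nonnegative-rank form ×
Schoenebeck's Sherali–Adams gap). [cite: ChanEtAl2016, Thm 3.1 and §3.4 (arXiv v3 p. 9–11)] [cite: Schoenebeck2008, §3] -/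
theorem maxKXor_nnr (hk : 3 ≤ k) {ε : ℝ} (hε : 0 < ε) {d : ℕ} (hkd : k ≤ d) :
    ∃ n₀ : ℕ, ∀ n : ℕ, n₀ ≤ n → ∀ R : ℕ, (R : ℝ) ≤ (n : ℝ) ^ ((d : ℝ) / 2) + 1 →
      ¬ HasNonnegFactorization (cspMatrix k n (literalClosure (xorK k)) (1 - ε) (1 / 2 + ε)) R := by
  obtain ⟨cε, hcε, n₁, H⟩ := Schoenebeck2008_maxKXorSA hk ε hε
  set m : ℕ := max n₁ ⌈(d : ℝ) / cε⌉₊ with hm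
  have hdm : d ≤ ⌊cε * m⌋₊ := by
    refine Nat.le_floor ?_
    have h1 : (d : ℝ) / cε ≤ ⌈(d : ℝ) / cε⌉₊ := Nat.le_ceil _
    have h2 : (⌈(d : ℝ) / cε⌉₊ : ℝ) ≤ m := by rw [hm]; exact_mod_cast le_max_right _ _
    calc (d : ℝ) = cε * ((d : ℝ) / cε) := by field_simp
      _ ≤ cε * m := by gcongr; exact h1.trans h2
  exact ChanEtAl2016_thm31_nnr (by omega) hkd (not_saAchieves_of_le (H m (le_max_left _ _)) hdm)

/-- **Max-`k`-XOR has no `(1−ε, 1/2+ε)`-approximate LP formulation (Braun–Pokutta–Zink) of size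
`≤ n^{d/2}`** (`k ≥ 3`, `d ≥ k`, all large `n`) — PROVED.
[cite: BraunPokuttaZink2015, Thm. 4.5 (`k`-XOR clause; here `n^{d/2}` for every `d`)] [cite: ChanEtAl2016, Thm 3.1] -/
theorem maxKXor_lpFormulation_poly (hk : 3 ≤ k) {ε : ℝ} (hε : 0 < ε) {d : ℕ} (hkd : k ≤ d) :
    ∃ n₀ : ℕ, ∀ n : ℕ, n₀ ≤ n → ∀ R : ℕ, (R : ℝ) ≤ (n : ℝ) ^ ((d : ℝ) / 2) →
      IsEmpty (LPFormulation (cspProblem k n (literalClosure (xorK k)) (1 - ε) (1 / 2 + ε)) R) := by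
  obtain ⟨n₀, H⟩ := maxKXor_nnr hk hε hkd
  refine ⟨n₀, fun n hn R hR => LPFormulation.isEmpty_of_not_hasNonnegFactorization fun h => ?_⟩
  refine H n hn (R + 1) (by push_cast; linarith) (hasNonnegFactorization_cspProblem_iff.1 h)

/-- **Weighted MaxCUT: no `((17−2ε)/21·W, (16+2ε)/21·W)`-approximate LP formulation of size `≤ N^C`,
`N = 1 + 2n + 36n³`, for all large `n` — UNCONDITIONAL** (Braun–Pokutta–Zink Thm. 4.5, MaxCUT clause, with
the gadget constant instead of the [CMM09]-based `(1−ε, 1/2+ε)`): the affine reduction `xorCutReduction`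
and `maxKXor_nnr`. [cite: BraunPokuttaZink2015, Thm. 4.5 (MaxCUT clause)] [cite: BraunPokuttaRoy2016, Thm. 3.2
and §7 (arXiv v3)] [cite: TrevisanEtAl2000, Lemma 4.3] -/
theorem maxCut_lpFormulation_poly {ε : ℝ} (hε : 0 < ε) (C : ℕ) :
    ∃ n₀ : ℕ, ∀ n : ℕ, n₀ ≤ n → ∀ R : ℕ, (R : ℝ) ≤ ((cutVars n : ℕ) : ℝ) ^ C →
      IsEmpty (LPFormulation (maxCutProblem (CutVertex n) ((17 - 2 * ε) / 21) ((16 + 2 * ε) / 21)) R) := by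
  obtain ⟨n₀, H⟩ := maxKXor_nnr (k := 3) le_rfl hε (d := 8 * C + 4) (by omega)
  refine ⟨max n₀ 37, fun n hn R hR => ?_⟩
  have hn₀ : n₀ ≤ n := le_trans (le_max_left _ _) hn
  have hn37 : 37 ≤ n := le_trans (le_max_right _ _) hn
  have h1 : (15 + 2 * (1 - ε)) / 21 = (17 - 2 * ε) / 21 := by ring
  have h2 : (15 + 2 * (1 / 2 + ε)) / 21 = (16 + 2 * ε) / 21 := by ring
  rw [← h1, ← h2]
  refine (xorCutReduction n (1 - ε) (1 / 2 + ε)).isEmpty_lpFormulation_affine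
    (fun I => 1 / (4 * (I.M : ℝ))) (fun _ => 0) (fun _ _ => rfl) (fun _ _ => rfl) fun h => ?_
  refine H n hn₀ (R + 2) ?_ (hasNonnegFactorization_cspProblem_iff.1 h)
  -- `R + 2 ≤ n^{4C} + 2 ≤ n^{4C+2} + 1`
  have hn0 : (0 : ℝ) < n := by exact_mod_cast lt_of_lt_of_le (by norm_num) hn37
  have hn3 : (0 : ℝ) ≤ (n : ℝ) ^ 3 := by positivity
  have hN : ((cutVars n : ℕ) : ℝ) ≤ (n : ℝ) ^ 4 := by
    rw [cutVars_eq]; push_cast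
    have hn37' : (37 : ℝ) ≤ n := by exact_mod_cast hn37
    have h4 : (n : ℝ) ^ 4 = n * n ^ 3 := by ring
    have h37 : 37 * (n : ℝ) ^ 3 ≤ n * n ^ 3 := mul_le_mul_of_nonneg_right hn37' hn3
    have hsq : (37 : ℝ) * 37 ≤ (n : ℝ) ^ 2 := by nlinarith
    have hcube : (2 : ℝ) * n + 1 ≤ (n : ℝ) ^ 3 := by nlinarith
    rw [h4]; linarith
  have hexp : (((8 * C + 4 : ℕ) : ℝ) / 2) = ((4 * C + 2 : ℕ) : ℝ) := by push_cast; ring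
  rw [hexp, Real.rpow_natCast]
  have hRC : (R : ℝ) ≤ (n : ℝ) ^ (4 * C) := by
    refine hR.trans ?_
    calc ((cutVars n : ℕ) : ℝ) ^ C ≤ ((n : ℝ) ^ 4) ^ C := pow_le_pow_left₀ (by positivity) hN C
      _ = (n : ℝ) ^ (4 * C) := by rw [← pow_mul]
  have hpow1 : (1 : ℝ) ≤ (n : ℝ) ^ (4 * C) := one_le_pow₀ (by
    have : (37 : ℝ) ≤ n := by exact_mod_cast hn37
    linarith)
  have hn4 : (4 : ℝ) ≤ (n : ℝ) ^ 2 := by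
    have : (37 : ℝ) ≤ n := by exact_mod_cast hn37
    nlinarith
  have hkey : (n : ℝ) ^ (4 * C) * 4 ≤ (n : ℝ) ^ (4 * C) * (n : ℝ) ^ 2 :=
    mul_le_mul_of_nonneg_left hn4 (by positivity)
  push_cast
  calc (R : ℝ) + 2 ≤ (n : ℝ) ^ (4 * C) + 2 := by linarith
    _ ≤ (n : ℝ) ^ (4 * C) * (n : ℝ) ^ 2 := by linarith
    _ = (n : ℝ) ^ (4 * C + 2) := by rw [← pow_add]
    _ ≤ (n : ℝ) ^ (4 * C + 2) + 1 := by linarith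

end Consequences

end Literature.Combinatorics.Optimization

end
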